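import Summits.QuantumAdvantage.AdviceFreeQNC0.NPGamma37Fourier
import HarnessLib

/-!
# Cell qa-qnc0 — (NP-ΓΛ) part 2: the character family of a slice (`IxL`, `rowsQ`, `coefsQ`, `sliceExpansionQ`) and the numerics

Planner qa-qnc0-p2 gen 34 (INBOX P2-34g, memo HOME/qa-qnc0-p2/ROUND-34P2.md §4.8).  Part of the (NP-ΓΛ)/(NP-Λ) proof
`NPGamma37Fourier` (statements, Fourier inversion on `𝔽₃^R`, the class, the slice expansion) → `NPGamma37FourierFamily`
(the explicit character family of a slice, numerics) → `NPGamma37FourierLoss` (assembly and the theorems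
`ringHardFourierSparse3`, `ringHardLinForms3`).
-/

noncomputable section

namespace Summit.QuantumAdvantage.AdviceFreeQNC0.NPGamma37Proof

open Finset F4
open Classical
open Summit.QuantumAdvantage.AdviceFreeQNC0.AffBells37 (expo chiZ exists_ne_one_of_mass_lt ev L sparse sparse_ne_one
  two_pow_L_le ωz ωz_zero ωz_add ωz_natCast ωz_sq ωz_sum lin chiZ_eq_ωz lin_add lin_mul lin_single ιF_xor ιF_decide_eq_zero
  ιF_eq_omega ιF_ringWinU)
open Summit.QuantumAdvantage.AdviceFreeQNC0.Resonance37G (four_orbit_le orbit_mgf sg bt sg_not slope_eq no_three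
  blockCpl blockCpl_blockCpl blockCpl_involutive blockCpl_apply_of_not_mem uExt_blockCpl xN xN_eq_xOfU xN_blockCpl_of_ne
  xN_blockCpl_left xN_blockCpl_right Inv letter resonance_windows)
-- `wt` (weight of a cube-restricted character) is written `AffBells37.wt` throughout: the bare name would resolve to the
-- walk-word weight `Summit.QuantumAdvantage.AdviceFreeQNC0.wt` of `Elimination.lean`.

variable {F : ℕ}

section Fourier

open Literature.Computability.QuantumComplexity Literature.Computability.QuantumComplexity.RingHLF
open Literature.Computability.MetaComplexity
open AffBells23 AffBells26
open Summit.QuantumAdvantage.AdviceFreeQNC0.NPGamma37 (NCoupled InsulatedWindows)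

variable {n : ℕ}
variable {N : ℕ}
variable {R : ℕ}

/-! ### The explicit character family of a slice -/

/-- index of the family: bell `g`, Frobenius branch `σ`, and the kind — `inl k` the Fourier test row `k ∈ 𝔽₃^R`
(`k = 0` the constant row), `inr (j, side, part)` the `tGuess` rows. -/
abbrev IxL (n F R : ℕ) : Type := Fin (n + 1) × Bool × ((Fin R → ZMod 3) ⊕ (Fin F × Bool × Bool))

/-- Cardinality of the index type: `|IxL n F R| = (n+1)·2·(3^R + 4F)`. -/
theorem card_IxL (n F R : ℕ) : Fintype.card (IxL n F R) = (n + 1) * (2 * (3 ^ R + 4 * F)) := by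
  simp only [IxL, Fintype.card_prod, Fintype.card_sum, Fintype.card_bool, Fintype.card_fin, Fintype.card_fun, ZMod.card]
  ring

/-- the rows. -/
def rowsQ (Q : Fin (n + 1) → Fin R → Smolensky.CubeFn (ZMod 3) (n + 1)) (p : ℕ → ℕ) (a : Fin n → Bool) :
    IxL n F R → Fin F → ZMod 3
  | (g, σ, Sum.inl k) => testRow (QK Q k) p a g (σv σ) 1
  | (g, σ, Sum.inr (j, _, part)) => pathRow p a g (σv σ) + (if part then Pi.single j 1 else 0)

/-- the coefficients. -/
def coefsQ (Q : Fin (n + 1) → Fin R → Smolensky.CubeFn (ZMod 3) (n + 1)) (f : Fin (n + 1) → (Fin R → ZMod 3) → Bool) (p : ℕ → ℕ)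
    (a : Fin n → Bool) : IxL n F R → F4
  | (g, σ, Sum.inl k) => ωz (σv σ * Eg a g) *
      (fc (f g) k * ωz (QK Q k g (xOfU a)) + if k = 0 then ιF (xOfU a g) + ιF (xOfU a (nxt g)) else 0)
  | (g, σ, Sum.inr (j, side, _)) =>
      if ((tgt g side).val = p j ∨ (tgt g side).val = p j + 1) then ω * ωz (σv σ * Eg a g) else 0

/-- mass bookkeeping of the rows: `tGuess` rows weigh `≥ F − 1`, Fourier test rows `F − Z`. -/
theorem mass_rows_leQ (Q : Fin (n + 1) → Fin R → Smolensky.CubeFn (ZMod 3) (n + 1)) (p : ℕ → ℕ) (a : Fin n → Bool) :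
    ∑ b : IxL n F R, 2 ^ (F - AffBells37.wt (rowsQ Q p a b))
      ≤ 2 * (n + 1) * (8 * F) +
        ∑ g : Fin (n + 1), ∑ σ : Bool, ∑ k : Fin R → ZMod 3, 2 ^ Zcount (F := F) (QK Q k) p a g (σv σ) 1 := by
  have hsplit : ∑ b : IxL n F R, (2 : ℕ) ^ (F - AffBells37.wt (rowsQ Q p a b))
      = ∑ g : Fin (n + 1), ∑ σ : Bool,
          ((∑ k : Fin R → ZMod 3, 2 ^ (F - AffBells37.wt (rowsQ Q p a ((g, σ, Sum.inl k) : IxL n F R))))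
          + ∑ t : Fin F × Bool × Bool, 2 ^ (F - AffBells37.wt (rowsQ Q p a ((g, σ, Sum.inr t) : IxL n F R)))) := by
    rw [Fintype.sum_prod_type]
    refine Fintype.sum_congr _ _ fun g => ?_
    rw [Fintype.sum_prod_type]
    refine Fintype.sum_congr _ _ fun σ => ?_
    rw [Fintype.sum_sum_type]
  rw [hsplit]
  have hinl : ∀ (g : Fin (n + 1)) (σ : Bool) (k : Fin R → ZMod 3),
      2 ^ (F - AffBells37.wt (rowsQ Q p a ((g, σ, Sum.inl k) : IxL n F R)))
        = 2 ^ Zcount (F := F) (QK Q k) p a g (σv σ) 1 := by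
    intro g σ k
    simp only [rowsQ]
    have h := wt_add_Zcount (F := F) (QK Q k) p a g (σv σ) 1
    rw [show F - AffBells37.wt (testRow (F := F) (QK Q k) p a g (σv σ) 1) = Zcount (F := F) (QK Q k) p a g (σv σ) 1
        by omega]
  have hinr : ∀ (g : Fin (n + 1)) (σ : Bool) (t : Fin F × Bool × Bool),
      2 ^ (F - AffBells37.wt (rowsQ Q p a ((g, σ, Sum.inr t) : IxL n F R))) ≤ 2 := by
    rintro g σ ⟨j, side, part⟩
    have hp := wt_pathRow p a g (σv_ne_zero σ) (F := F)
    cases part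
    · simp only [rowsQ, Bool.false_eq_true, if_false, add_zero]
      rw [hp, Nat.sub_self, pow_zero]; norm_num
    · simp only [rowsQ, if_true]
      have h1 := wt_add_single_ge (pathRow p a g (σv σ)) j
      rw [hp] at h1
      calc 2 ^ (F - AffBells37.wt (pathRow p a g (σv σ) + Pi.single j (1 : ZMod 3)))
          ≤ 2 ^ 1 := Nat.pow_le_pow_right (by norm_num) (by omega)
        _ = 2 := by norm_num
  have hblock : ∀ (g : Fin (n + 1)) (σ : Bool),
      ((∑ k : Fin R → ZMod 3, 2 ^ (F - AffBells37.wt (rowsQ Q p a ((g, σ, Sum.inl k) : IxL n F R))))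
        + ∑ t : Fin F × Bool × Bool, 2 ^ (F - AffBells37.wt (rowsQ Q p a ((g, σ, Sum.inr t) : IxL n F R))))
      ≤ 8 * F + ∑ k : Fin R → ZMod 3, 2 ^ Zcount (F := F) (QK Q k) p a g (σv σ) 1 := by
    intro g σ
    have h1 : ∑ k : Fin R → ZMod 3, 2 ^ (F - AffBells37.wt (rowsQ Q p a ((g, σ, Sum.inl k) : IxL n F R)))
        = ∑ k : Fin R → ZMod 3, 2 ^ Zcount (F := F) (QK Q k) p a g (σv σ) 1 :=
      Fintype.sum_congr _ _ (hinl g σ)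
    have h2 : ∑ t : Fin F × Bool × Bool, 2 ^ (F - AffBells37.wt (rowsQ Q p a ((g, σ, Sum.inr t) : IxL n F R))) ≤ 8 * F := by
      calc ∑ t : Fin F × Bool × Bool, 2 ^ (F - AffBells37.wt (rowsQ Q p a ((g, σ, Sum.inr t) : IxL n F R)))
          ≤ ∑ _t : Fin F × Bool × Bool, 2 := sum_le_sum fun t _ => hinr g σ t
        _ = 8 * F := by
          rw [sum_const, card_univ, smul_eq_mul, Fintype.card_prod, Fintype.card_prod, Fintype.card_bool,
            Fintype.card_fin]
          ring
    rw [h1]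
    omega
  calc ∑ g : Fin (n + 1), ∑ σ : Bool,
        ((∑ k : Fin R → ZMod 3, 2 ^ (F - AffBells37.wt (rowsQ Q p a ((g, σ, Sum.inl k) : IxL n F R))))
          + ∑ t : Fin F × Bool × Bool, 2 ^ (F - AffBells37.wt (rowsQ Q p a ((g, σ, Sum.inr t) : IxL n F R))))
      ≤ ∑ g : Fin (n + 1), ∑ σ : Bool,
          (8 * F + ∑ k : Fin R → ZMod 3, 2 ^ Zcount (F := F) (QK Q k) p a g (σv σ) 1) :=
        sum_le_sum fun g _ => sum_le_sum fun σ _ => hblock g σ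
    _ = _ := by
        simp only [sum_add_distrib, sum_const, card_univ, Fintype.card_bool, Fintype.card_fin, smul_eq_mul]
        ring

/-- **LEMMA BLOCK-Λ**: the rows and coefficients of block `(g, σ)` sum to `P_σ · ι(y_g)`-slice-part. -/
theorem blockQ (Q : Fin (n + 1) → Fin R → Smolensky.CubeFn (ZMod 3) (n + 1)) (f : Fin (n + 1) → (Fin R → ZMod 3) → Bool)
    (p : ℕ → ℕ) (a : Fin n → Bool) (v : Fin F → Bool) (g : Fin (n + 1)) (σ : Bool) :
    (∑ k : Fin R → ZMod 3, coefsQ Q f p a ((g, σ, Sum.inl k) : IxL n F R)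
        * chiZ (rowsQ Q p a ((g, σ, Sum.inl k) : IxL n F R)) v)
      + ∑ t : Fin F × Bool × Bool, coefsQ Q f p a ((g, σ, Sum.inr t) : IxL n F R)
        * chiZ (rowsQ Q p a ((g, σ, Sum.inr t) : IxL n F R)) v
      = Pσ p a g σ v * ((∑ k : Fin R → ZMod 3, BkQ Q f p a g k v) + (Gx p a v g + Gx p a v (nxt g))) := by
  have hrow : ∀ k : Fin R → ZMod 3, chiZ (testRow (QK Q k) p a g (σv σ) 1) v
      = chiZ (rv (QK Q k) p a g) v * chiZ (pathRow p a g (σv σ)) v := by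
    intro k
    rw [chiZ_eq_ωz, chiZ_eq_ωz, chiZ_eq_ωz, ← ωz_add, ← lin_add]
    congr 1
    unfold testRow
    congr 1
    funext j
    rw [Pi.add_apply, one_mul]
  have hinl : ∀ k : Fin R → ZMod 3, coefsQ Q f p a ((g, σ, Sum.inl k) : IxL n F R)
        * chiZ (rowsQ Q p a ((g, σ, Sum.inl k) : IxL n F R)) v
      = Pσ p a g σ v * BkQ Q f p a g k v
        + (if k = 0 then Pσ p a g σ v * (ιF (xOfU a g) + ιF (xOfU a (nxt g))) else 0) := by
    intro k
    by_cases hk : k = 0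
    · subst hk
      simp only [coefsQ, rowsQ, if_true]
      rw [hrow]
      unfold Pσ BkQ
      rw [rv_QK_zero, chiZ_zero, QK_zero_apply, ωz_zero]
      ring
    · simp only [coefsQ, rowsQ, hk, if_false, add_zero]
      rw [hrow]
      unfold Pσ BkQ
      ring
  have hinr : ∀ j : Fin F, ∀ side : Bool,
      ∑ part : Bool, coefsQ Q f p a ((g, σ, Sum.inr (j, side, part)) : IxL n F R)
          * chiZ (rowsQ Q p a ((g, σ, Sum.inr (j, side, part)) : IxL n F R)) v
        = Pσ p a g σ v * (if ((tgt g side).val = p j ∨ (tgt g side).val = p j + 1)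
            then ω * (1 + ωz (if v j then 1 else 0)) else 0) := by
    intro j side
    rw [Fintype.sum_bool]
    simp only [coefsQ, rowsQ, if_true, Bool.false_eq_true, if_false, add_zero]
    by_cases hc : (tgt g side).val = p j ∨ (tgt g side).val = p j + 1
    · simp only [if_pos hc]
      unfold Pσ
      rw [chiZ_eq_ωz, chiZ_eq_ωz, lin_add, lin_single, ωz_add]
      ring
    · simp only [if_neg hc]
      ring
  have hinr' : ∑ t : Fin F × Bool × Bool, coefsQ Q f p a ((g, σ, Sum.inr t) : IxL n F R)
        * chiZ (rowsQ Q p a ((g, σ, Sum.inr t) : IxL n F R)) v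
      = ∑ j : Fin F,
          (Pσ p a g σ v * (if ((nxt g).val = p j ∨ (nxt g).val = p j + 1) then ω * (1 + ωz (if v j then 1 else 0)) else 0)
          + Pσ p a g σ v * (if (g.val = p j ∨ g.val = p j + 1) then ω * (1 + ωz (if v j then 1 else 0)) else 0)) := by
    rw [Fintype.sum_prod_type]
    refine Fintype.sum_congr _ _ fun j => ?_
    rw [Fintype.sum_prod_type, Fintype.sum_bool, hinr, hinr]
    simp only [tgt, if_true, Bool.false_eq_true, if_false]
  have h3 : ∑ k : Fin R → ZMod 3, (if k = 0 then Pσ p a g σ v * (ιF (xOfU a g) + ιF (xOfU a (nxt g))) else 0)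
      = Pσ p a g σ v * (ιF (xOfU a g) + ιF (xOfU a (nxt g))) := by
    simp only [Finset.sum_ite_eq', Finset.mem_univ, if_true]
  rw [Fintype.sum_congr _ _ hinl, sum_add_distrib, h3, hinr', sum_add_distrib, ← mul_sum, ← mul_sum, ← mul_sum]
  unfold Gx
  ring

/-- **(E′-Λ) THE SLICE EXPANSION** for the linear-forms class. -/
theorem sliceExpansionQ {p : ℕ → ℕ} (hS : Sep n F p)
    (Q : Fin (n + 1) → Fin R → Smolensky.CubeFn (ZMod 3) (n + 1)) (f : Fin (n + 1) → (Fin R → ZMod 3) → Bool)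
    (hSA : ∀ (k : Fin R → ZMod 3) (g : Fin (n + 1)), SA (n := n) p F (QK Q k g))
    (a : Fin n → Bool) (v : Fin F → Bool) :
    ιF (Wn (PQ Q f) (U p a v)) = ev univ (rowsQ Q p a) (coefsQ Q f p a) v := by
  unfold Wn
  rw [ιF_ringWinU]
  unfold ev
  rw [Fintype.sum_prod_type]
  refine Fintype.sum_congr _ _ fun g => ?_
  rw [ιF_yOf_UQ hS Q f g (fun k => hSA k g) a v, tr_label_U hS, Fintype.sum_prod_type, mul_sum]
  refine Fintype.sum_congr _ _ fun σ => ?_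
  rw [Fintype.sum_sum_type, blockQ]
  exact mul_comm _ _

/-- losing points seen through a slice are counted by the family. -/
theorem card_loss_sliceQ {p : ℕ → ℕ} (hS : Sep n F p)
    (Q : Fin (n + 1) → Fin R → Smolensky.CubeFn (ZMod 3) (n + 1)) (f : Fin (n + 1) → (Fin R → ZMod 3) → Bool)
    (hSA : ∀ (k : Fin R → ZMod 3) (g : Fin (n + 1)), SA (n := n) p F (QK Q k g))
    (a : Fin n → Bool) :
    (univ.filter fun v : Fin F → Bool => ev univ (rowsQ Q p a) (coefsQ Q f p a) v ≠ 1).card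
      = (univ.filter fun v : Fin F → Bool => Wn (PQ Q f) (U p a v) = false).card := by
  refine congrArg Finset.card (filter_congr fun v _ => ?_)
  rw [← sliceExpansionQ hS Q f hSA a v]
  haveI := F4.nontrivial
  unfold ιF
  cases Wn (PQ Q f) (U p a v)
  · simp
  · simp

/-! ### The numerics `F = 8k`, `k = log₂ (n+1) ≥ 7`, `R ≤ k` -/

/-- Numerics: `16·39366^k ≤ 65536^k` for `k ≥ 6`. -/
theorem growthC (k : ℕ) (hk : 6 ≤ k) : 16 * 39366 ^ k ≤ 65536 ^ k := by
  induction k, hk using Nat.le_induction with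
  | base => norm_num
  | succ k hk ih =>
    calc 16 * 39366 ^ (k + 1) = 39366 * (16 * 39366 ^ k) := by ring
      _ ≤ 65536 * 65536 ^ k := Nat.mul_le_mul (by norm_num) ih
      _ = 65536 ^ (k + 1) := by ring

/-- Numerics: `512k·2^k ≤ 256^k` for `k ≥ 2`. -/
theorem growthD (k : ℕ) (hk : 2 ≤ k) : 512 * k * 2 ^ k ≤ 256 ^ k := by
  induction k, hk using Nat.le_induction with
  | base => norm_num
  | succ k hk ih =>
    have hstep : 512 * (k + 1) * 2 ^ (k + 1) ≤ 4 * (512 * k * 2 ^ k) := by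
      have : 2 * (k + 1) ≤ 4 * k := by omega
      calc 512 * (k + 1) * 2 ^ (k + 1) = (2 * (k + 1)) * (512 * 2 ^ k) := by ring
        _ ≤ (4 * k) * (512 * 2 ^ k) := Nat.mul_le_mul_right _ this
        _ = 4 * (512 * k * 2 ^ k) := by ring
    calc 512 * (k + 1) * 2 ^ (k + 1) ≤ 4 * (512 * k * 2 ^ k) := hstep
      _ ≤ 256 * 256 ^ k := Nat.mul_le_mul (by norm_num) ih
      _ = 256 ^ (k + 1) := by ring

/-- Numerics: `24k + 4 ≤ 2^k` for `k ≥ 9`. -/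
theorem growthE (k : ℕ) (hk : 9 ≤ k) : 24 * k + 4 ≤ 2 ^ k := by
  induction k, hk using Nat.le_induction with
  | base => norm_num
  | succ k hk ih =>
    have h2 : 24 ≤ 2 ^ k := le_trans (by norm_num) (Nat.pow_le_pow_right (by norm_num) hk : 2 ^ 9 ≤ 2 ^ k)
    calc 24 * (k + 1) + 4 = (24 * k + 4) + 24 := by ring
      _ ≤ 2 ^ k + 2 ^ k := add_le_add ih h2
      _ = 2 ^ (k + 1) := by ring

/-- the four numeric facts of the assembly at `N = n + 1 ≥ 200`, `k = log₂ N`, `R ≤ k`. -/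
theorem numericsΛ (hN : 200 ≤ n + 1) (hR : R ≤ Nat.log 2 (n + 1)) :
    8 * 3 ^ R * (n + 1) * 3 ^ (8 * Nat.log 2 (n + 1)) ≤ 4 ^ (8 * Nat.log 2 (n + 1)) ∧
    4 * (n + 1) * (8 * (8 * Nat.log 2 (n + 1))) ≤ 2 ^ (8 * Nat.log 2 (n + 1)) ∧
    2 * 2 ^ L ((n + 1) * (2 * (3 ^ R + 4 * (8 * Nat.log 2 (n + 1)))) + 1) ≤ (n + 1) ^ 7 ∧
    24 * Nat.log 2 (n + 1) + 4 ≤ n + 1 := by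
  set k := Nat.log 2 (n + 1) with hk
  have hk7 : 7 ≤ k := by
    rw [hk]
    exact Nat.le_log_of_pow_le (by norm_num) (by omega)
  have hNlt : n + 1 < 2 ^ (k + 1) := Nat.lt_pow_succ_log_self (by norm_num) (n + 1)
  have h2k : 2 ^ k ≤ n + 1 := Nat.pow_log_le_self 2 (by omega)
  have hkN : k < n + 1 := lt_of_lt_of_le (Nat.lt_two_pow_self) h2k
  have h3R : 3 ^ R ≤ (n + 1) ^ 2 := by
    calc 3 ^ R ≤ 3 ^ k := Nat.pow_le_pow_right (by norm_num) hR
      _ ≤ 4 ^ k := Nat.pow_le_pow_left (by norm_num) k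
      _ = (2 ^ k) ^ 2 := by rw [← pow_mul, mul_comm, pow_mul]; norm_num
      _ ≤ (n + 1) ^ 2 := Nat.pow_le_pow_left h2k 2
  refine ⟨?_, ?_, ?_, ?_⟩
  · have hA := growthC k (by omega)
    have h3 : 3 ^ R ≤ 3 ^ k := Nat.pow_le_pow_right (by norm_num) hR
    calc 8 * 3 ^ R * (n + 1) * 3 ^ (8 * k) ≤ 8 * 3 ^ k * 2 ^ (k + 1) * 3 ^ (8 * k) :=
          Nat.mul_le_mul_right _ (Nat.mul_le_mul (Nat.mul_le_mul_left _ h3) hNlt.le)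
      _ = 16 * (3 ^ k * 2 ^ k * (3 ^ 8) ^ k) := by rw [← pow_mul]; ring
      _ = 16 * 39366 ^ k := by rw [← mul_pow, ← mul_pow]; norm_num
      _ ≤ 65536 ^ k := hA
      _ = 4 ^ (8 * k) := by rw [pow_mul]; norm_num
  · have hB := growthD k (by omega)
    calc 4 * (n + 1) * (8 * (8 * k)) ≤ 4 * 2 ^ (k + 1) * (8 * (8 * k)) :=
          Nat.mul_le_mul_right _ (Nat.mul_le_mul_left _ hNlt.le)
      _ = 512 * k * 2 ^ k := by ring
      _ ≤ 256 ^ k := hB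
      _ = 2 ^ (8 * k) := by rw [pow_mul]; norm_num
  · have hL := two_pow_L_le ((n + 1) * (2 * (3 ^ R + 4 * (8 * k))) + 1) (by omega)
    have hq : (n + 1) * (2 * (3 ^ R + 4 * (8 * k))) + 1 ≤ 4 * (n + 1) ^ 3 := by
      have h1 : (n + 1) * (2 * (3 ^ R + 4 * (8 * k))) ≤ (n + 1) * (2 * ((n + 1) ^ 2 + 4 * (8 * k))) :=
        Nat.mul_le_mul_left _ (Nat.mul_le_mul_left _ (Nat.add_le_add_right h3R _))
      have h2 : 2 * (n + 1) * (4 * (8 * k)) + 1 ≤ 2 * (n + 1) ^ 3 := by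
        have hk' : 4 * (8 * k) ≤ 32 * (n + 1) := by omega
        calc 2 * (n + 1) * (4 * (8 * k)) + 1 ≤ 2 * (n + 1) * (32 * (n + 1)) + (n + 1) * (n + 1) := by
              have := Nat.mul_le_mul_left (2 * (n + 1)) hk'
              have h1' : 1 ≤ (n + 1) * (n + 1) := Nat.one_le_iff_ne_zero.mpr (by positivity)
              omega
          _ = 65 * (n + 1) ^ 2 := by ring
          _ ≤ (2 * (n + 1)) * (n + 1) ^ 2 := Nat.mul_le_mul_right _ (by omega)
          _ = 2 * (n + 1) ^ 3 := by ring
      calc (n + 1) * (2 * (3 ^ R + 4 * (8 * k))) + 1 ≤ (n + 1) * (2 * ((n + 1) ^ 2 + 4 * (8 * k))) + 1 :=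
            Nat.add_le_add_right h1 1
        _ = 2 * (n + 1) ^ 3 + (2 * (n + 1) * (4 * (8 * k)) + 1) := by ring
        _ ≤ 2 * (n + 1) ^ 3 + 2 * (n + 1) ^ 3 := Nat.add_le_add_left h2 _
        _ = 4 * (n + 1) ^ 3 := by ring
    have hq2 : ((n + 1) * (2 * (3 ^ R + 4 * (8 * k))) + 1) ^ 2 ≤ (4 * (n + 1) ^ 3) ^ 2 := Nat.pow_le_pow_left hq 2
    have h128 : 128 ≤ n + 1 := by omega
    calc 2 * 2 ^ L ((n + 1) * (2 * (3 ^ R + 4 * (8 * k))) + 1) ≤ 2 * (4 * (4 * (n + 1) ^ 3) ^ 2) :=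
          Nat.mul_le_mul_left 2 (hL.trans (Nat.mul_le_mul_left 4 hq2))
      _ = 128 * (n + 1) ^ 6 := by ring
      _ ≤ (n + 1) * (n + 1) ^ 6 := Nat.mul_le_mul_right _ h128
      _ = (n + 1) ^ 7 := by ring
  · by_cases hk8 : k ≤ 8
    · omega
    · exact (growthE k (by omega)).trans h2k

/-- from the core loss bound to the `1 − N^{−7}` law. -/
theorem law_of_loss {c K : ℕ} (hmain : ((c : ℕ) : ℝ) ≤ (2 : ℝ) ^ n - (2 : ℝ) ^ n / (2 * (2 : ℝ) ^ L (K + 1)))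
    (hK : 2 * 2 ^ L (K + 1) ≤ (n + 1) ^ 7) :
    ((c : ℕ) : ℝ) ≤ (1 - 1 / ((n : ℝ) + 1) ^ 7) * (2 : ℝ) ^ n := by
  have hKR : 2 * (2 : ℝ) ^ L (K + 1) ≤ ((n : ℝ) + 1) ^ 7 := by exact_mod_cast hK
  have h2n : (0 : ℝ) < (2 : ℝ) ^ n := by positivity
  have hdiv : (2 : ℝ) ^ n / ((n : ℝ) + 1) ^ 7 ≤ (2 : ℝ) ^ n / (2 * (2 : ℝ) ^ L (K + 1)) :=
    div_le_div_of_nonneg_left h2n.le (by positivity) hKR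
  calc ((c : ℕ) : ℝ) ≤ (2 : ℝ) ^ n - (2 : ℝ) ^ n / (2 * (2 : ℝ) ^ L (K + 1)) := hmain
    _ ≤ (2 : ℝ) ^ n - (2 : ℝ) ^ n / ((n : ℝ) + 1) ^ 7 := by linarith
    _ = (1 - 1 / ((n : ℝ) + 1) ^ 7) * (2 : ℝ) ^ n := by ring


end Fourier

end Summit.QuantumAdvantage.AdviceFreeQNC0.NPGamma37Proof
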